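import Summits.BirchSwinnertonDyer.BirchSwinnertonDyer.Theorems.EisensteinPrimesBSDpOnCellCTelescopeBranchTwistExpSeries
import Literature.NumberTheory.EllipticCurves.PAdicHeightsLogProofs
import Literature.NumberTheory.GaloisRepresentations.GaloisRep
import HarnessLib

/-!
# [telescope — width x2-p2 g24, 2026-08-30] THE CRITICAL TWIST CHARACTER `Θ : Γ_ℚ →ₜ* ℤ_p⟦X⟧ˣ` over the rescaled weight variable:
# `Θ(σ) = exp(c_σ X)`, `c_σ = −(p^M/(2(p−1)))·log(ε(σ)^{p−1})` (`p` odd), with `Θ(σ)(0) = 1`, `Θ(σ)(x_t) = ε(σ)^{1−k_t/2}` at every member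
# point (`p^M x_t = k_t − 2`, `2(p−1) ∣ k_t − 2`), trivial on inertia away from `p` — transcription step (D8), flag `TG-twist`, of the
# assembled fact T-An-2ᵍ, PROVED
# Crux 4 `BSDpOnCellC` (stmt-BirchSwinnertonDyer-19034), line «telescope» (`--supports`, helper; closes nothing)

WHY: see `…TelescopeBranchTwistExpSeries`. With `Θ`, a branch lattice whose member fibres are Deligne's UNTWISTED representations
`(D t).Δ.ρ` (Hida 1986 Thm. 2.1 (2.2c) verbatim) twists — `FramedRep.twist ρ' Θ` — into one whose member fibres are the critical
twists `(D t).Δ.selfDualRep = Δ.ρ ⊗ ε^{1−k_t/2}` that `IsBranchGaloisLattice` (G-fib_t) asks for, with the `X = 0` fibre and the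
ramification away from `p` unchanged (sequel `…TelescopeBranchLatticeOfUntwisted`). Construction: `ε = GaloisRep.cyclotomicCharacter ℚ p`;
`u_σ := ε(σ)^{p−1} ∈ 1 + pℤ_p` (no Teichmüller character needed); `c_σ := −(p^M/(2(p−1)))·plog u_σ`, an additive continuous map
`Γ_ℚ → p ℤ_p` (`plog` = the tree's logarithmic series, an isometric homomorphism on `1 + pℤ_p`); `Θ(σ) := E_{c_σ} = Σ (c_σⁿ/n!) Xⁿ`
(`…TwistExpSeries.exists_expSeries`), multiplicative in `σ` (`expSeries_mul`), continuous coefficientwise (product topology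
`PowerSeries.WithPiTopology`), with `evalHom x_t Θ(σ) = exp(c_σ x_t) = exp(−m_t · plog u_σ) = u_σ^{−m_t} = ε(σ)^{−(p−1)m_t} = ε(σ)^{1−k_t/2}`
where `k_t − 2 = 2(p−1)m_t` (`coe_evalHom_expSeries_eq_zpow`).

CONTENT (namespace `…Theorems.TelescopeBranchTwistCharacter`; THEOREMS ONLY): §1 arithmetic of `ε`, `u_σ`, `c_σ` (norms, additivity,
continuity, triviality on inertia away from `p`); §2 **`exists_twistCharacter`** — THE statement: for `p ≠ 2`, `M`, member points
`x : ℕ → ℤ_p` in the open disc and weights `k : ℕ → ℤ` with (wt) and (memb), THERE IS `Θ : Γ_ℚ →ₜ* (ℤ_p⟦X⟧)ˣ` with (i) `constantCoeff (Θ σ) = 1`,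
(ii) `evalHom (x t) (Θ σ) = ε(σ)^{1 − k_t/2}` (in `ℤ_pˣ`, and coerced to `ℚ_p`), (iii) `Θ σ = 1` for `σ` in any inertia group at a finite
place `v ∤ p`.

HONEST FRAMING: an explicit character; no Galois LATTICE is constructed here; closes no registered stub, no crux, no summit statement;
BSD is proved for no curve by this file. No named fact, no definition, no instance, no `sorry`.
References (shape only): [cite: Howard2007BigHeegner, Def. 2.1.3, Rem. 2.1.4 (the critical character `Θ`)] [cite: Hida1986, Thm. 2.1 (2.2c)]
-/

set_option autoImplicit false
set_option linter.dupNamespace false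

noncomputable section

open scoped Classical PowerSeries.WithPiTopology
open Filter PowerSeries NormedSpace IsDedekindDomain NumberField
open Literature.NumberTheory.EllipticCurves Literature.NumberTheory.LocalFields Literature.NumberTheory.Transcendental
  Literature.NumberTheory.GaloisRepresentations
  Summit.BirchSwinnertonDyer.BirchSwinnertonDyer.Theorems.TelescopeBranchTwistExpSeries

namespace Summit.BirchSwinnertonDyer.BirchSwinnertonDyer.Theorems.TelescopeBranchTwistCharacter

variable {p : ℕ} [hp : Fact p.Prime]

/-! ### §1. `u_σ = ε(σ)^{p−1} ∈ 1 + pℤ_p` and the additive exponent `c_σ = −q · plog u_σ` -/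

/-- A unit of `ℤ_p` has norm `1` in `ℚ_p`. [folklore] -/
theorem norm_coe_units_eq_one (e : ℤ_[p]ˣ) : ‖(((e : ℤ_[p]ˣ) : ℤ_[p]) : ℚ_[p])‖ = 1 := by
  rw [PadicInt.padic_norm_e_of_padicInt]
  exact PadicInt.isUnit_iff.mp e.isUnit

/-- `u = e^{p−1}` is a principal unit: `‖u − 1‖ ≤ p⁻¹` (Fermat; the tree's `norm_one_sub_pow_sub_one_lt` + discreteness of `|·|_p`).
[folklore] -/
theorem norm_units_pow_sub_one_le (e : ℤ_[p]ˣ) :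
    ‖(((e : ℤ_[p]ˣ) : ℤ_[p]) : ℚ_[p]) ^ (p - 1) - 1‖ ≤ (p : ℝ)⁻¹ := by
  rw [norm_sub_rev]
  exact norm_le_inv_of_norm_lt_one (norm_one_sub_pow_sub_one_lt (norm_coe_units_eq_one e))

/-- `‖1 − e^{p−1}‖ < 1`. [folklore] -/
theorem norm_one_sub_units_pow_lt (e : ℤ_[p]ˣ) : ‖1 - (((e : ℤ_[p]ˣ) : ℤ_[p]) : ℚ_[p]) ^ (p - 1)‖ < 1 :=
  norm_one_sub_pow_sub_one_lt (norm_coe_units_eq_one e)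

/-- `2(p−1)` is prime to the odd prime `p`. [folklore] -/
theorem coprime_two_mul_sub_one (hp2 : p ≠ 2) : (2 * (p - 1)).Coprime p := by
  have hP : p.Prime := hp.out
  refine (hP.coprime_iff_not_dvd.mpr fun h => ?_).symm
  rcases hP.dvd_mul.mp h with h2 | h1
  · exact hp2 ((Nat.prime_dvd_prime_iff_eq hP Nat.prime_two).mp h2)
  · have h2 := Nat.le_of_dvd (Nat.sub_pos_of_lt hP.one_lt) h1
    have h3 := hP.one_lt
    omega

/-- The rescaling constant `q = p^M / (2(p−1))` has `‖q‖ ≤ 1` (`p` odd). [folklore] -/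
theorem norm_q_le_one (hp2 : p ≠ 2) (M : ℕ) : ‖(p : ℚ_[p]) ^ M / ((2 * (p - 1) : ℕ) : ℚ_[p])‖ ≤ 1 := by
  rw [div_eq_mul_inv, norm_mul, PadicExp.norm_inv_natCast_eq_one_of_coprime (ℓ := p) (coprime_two_mul_sub_one hp2), mul_one, norm_pow]
  exact pow_le_one₀ (norm_nonneg _) (Padic.norm_p_lt_one (p := p)).le

/-- `‖q · plog u‖ ≤ p⁻¹` for a principal unit `‖u − 1‖ ≤ p⁻¹` (`plog` is an isometry there). [cite: Robert2000PadicAnalysis, Ch. V §4.2 Prop. 1] -/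
theorem norm_q_mul_plog_le (hp2 : p ≠ 2) (M : ℕ) {u : ℚ_[p]} (hu : ‖u - 1‖ ≤ (p : ℝ)⁻¹) :
    ‖-((p : ℚ_[p]) ^ M / ((2 * (p - 1) : ℕ) : ℚ_[p]) * PadicExp.plog u)‖ ≤ (p : ℝ)⁻¹ := by
  have hu' : ‖1 - u‖ ≤ (p : ℝ)⁻¹ := by rwa [norm_sub_rev]
  rw [norm_neg, norm_mul, norm_plog_of_norm_one_sub_lt_radius (p := p) (hu'.trans_lt (inv_lt_rpow_radius hp2))]
  exact (mul_le_of_le_one_left (norm_nonneg _) (norm_q_le_one hp2 M)).trans hu'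

/-- `plog` is continuous along any continuous family of principal units `‖u − 1‖ ≤ p⁻¹` (it is an isometry there).
[cite: Robert2000PadicAnalysis, Ch. V §4.2 Theorem] -/
theorem continuous_plog_comp (hp2 : p ≠ 2) {G : Type*} [TopologicalSpace G] {u : G → ℚ_[p]} (hu : Continuous u)
    (h1 : ∀ g, ‖u g - 1‖ ≤ (p : ℝ)⁻¹) : Continuous fun g => PadicExp.plog (u g) := by
  have hr := inv_lt_rpow_radius (p := p) hp2
  refine continuous_iff_continuousAt.2 fun g₀ => ?_
  have h0 := hu.tendsto g₀
  rw [tendsto_iff_norm_sub_tendsto_zero] at h0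
  rw [ContinuousAt, tendsto_iff_norm_sub_tendsto_zero]
  refine h0.congr fun g => ?_
  have hg : ‖1 - u g‖ < (p : ℝ) ^ (-(1 : ℝ) / ((p : ℝ) - 1)) := by rw [norm_sub_rev]; exact (h1 g).trans_lt hr
  have hg₀ : ‖1 - u g₀‖ < (p : ℝ) ^ (-(1 : ℝ) / ((p : ℝ) - 1)) := by rw [norm_sub_rev]; exact (h1 g₀).trans_lt hr
  rw [norm_plog_sub_plog_of_lt_radius (p := p) hg hg₀]

/-- The cyclotomic character is trivial on inertia away from `p`: `ε(σ) = 1` for `σ ∈ I_𝔓`, `𝔓 ∣ v`, `v ∤ p` (the tree's proof of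
`FramedGaloisRep.isUnramifiedAt_cyclotomic_holds`). [cite: SerreAbelianLadic1968, Ch. I §1.2 (Example: the cyclotomic character)] -/
theorem cyclotomicCharacter_eq_one_of_mem_inertia {v : HeightOneSpectrum (𝓞 ℚ)} (hv : ((p : ℕ) : 𝓞 ℚ) ∉ v.asIdeal)
    {𝔓 : Ideal (absIntegers (𝓞 ℚ) ℚ)} (h𝔓 : 𝔓 ∈ v.primesAbove) {σ : Field.absoluteGaloisGroup ℚ}
    (hσ : σ ∈ 𝔓.inertia (Field.absoluteGaloisGroup ℚ)) : GaloisRep.cyclotomicCharacter ℚ p σ = 1 := by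
  rw [GaloisRep.cyclotomicCharacter_apply]
  exact cyclotomicCharacter_eq_one_of_forall_pow_eq_one p _ fun n t ht =>
    smul_eq_self_of_mem_inertia_of_pow_prime_pow_eq_one hv h𝔓 hσ ht

/-! ### §2. The character -/

set_option maxHeartbeats 800000 in
/-- **The critical twist character over `ℤ_p⟦X⟧`.** Let `p ≠ 2`, `M : ℕ`, member points `x : ℕ → ℤ_p` in the open unit disc and weights
`k : ℕ → ℤ` with (wt) `p^M · x_t = k_t − 2` and (memb) `2(p−1) ∣ k_t − 2`. THEN there is a continuous character
`Θ : Γ_ℚ →ₜ* (ℤ_p⟦X⟧)ˣ` (product topology on `ℤ_p⟦X⟧`) such that: (i) `Θ(σ) ≡ 1 (mod X)`; (ii) at every member point,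
`evalHom (x t) Θ(σ) = ε(σ)^{1 − k_t/2}` (`ε = GaloisRep.cyclotomicCharacter ℚ p`; the exponent of `selfDualTwistChar`), stated in `ℤ_p`
and in `ℚ_p`; (iii) `Θ(σ) = 1` for `σ` in the inertia group of any prime above a finite place `v ∤ p`. (`Θ(σ) = Σ (c_σⁿ/n!) Xⁿ`,
`c_σ = −(p^M/(2(p−1)))·plog(ε(σ)^{p−1})`.) [cite: Howard2007BigHeegner, Def. 2.1.3 and Rem. 2.1.4 (the critical character `Θ`)] -/
theorem exists_twistCharacter (hp2 : p ≠ 2) (M : ℕ) {x : ℕ → ℤ_[p]} (hx : ∀ t, ‖x t‖ < 1) {k : ℕ → ℤ}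
    (hwt : ∀ t, ((p : ℤ_[p]) ^ M) * x t = ((k t - 2 : ℤ) : ℤ_[p])) (hmemb : ∀ t, 2 * ((p : ℤ) - 1) ∣ k t - 2) :
    ∃ Θ : Field.absoluteGaloisGroup ℚ →ₜ* (PowerSeries ℤ_[p])ˣ,
      (∀ σ, constantCoeff (((Θ σ : (PowerSeries ℤ_[p])ˣ)) : PowerSeries ℤ_[p]) = 1) ∧
      (∀ t σ, evalHom (x t) (hx t) (((Θ σ : (PowerSeries ℤ_[p])ˣ)) : PowerSeries ℤ_[p]) =
        (((GaloisRep.cyclotomicCharacter ℚ p σ ^ (1 - k t / 2) : ℤ_[p]ˣ)) : ℤ_[p])) ∧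
      (∀ t σ, (((evalHom (x t) (hx t) (((Θ σ : (PowerSeries ℤ_[p])ˣ)) : PowerSeries ℤ_[p]) : ℤ_[p])) : ℚ_[p]) =
        ((((GaloisRep.cyclotomicCharacter ℚ p σ : ℤ_[p]ˣ)) : ℤ_[p]) : ℚ_[p]) ^ (1 - k t / 2)) ∧
      (∀ (v : HeightOneSpectrum (𝓞 ℚ)), ((p : ℕ) : 𝓞 ℚ) ∉ v.asIdeal → ∀ 𝔓 ∈ v.primesAbove,
        ∀ σ ∈ 𝔓.inertia (Field.absoluteGaloisGroup ℚ), Θ σ = 1) := by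
  -- notation
  set ε : Field.absoluteGaloisGroup ℚ →ₜ* ℤ_[p]ˣ := GaloisRep.cyclotomicCharacter ℚ p with hε
  let eQ : Field.absoluteGaloisGroup ℚ → ℚ_[p] := fun σ => (((ε σ : ℤ_[p]ˣ) : ℤ_[p]) : ℚ_[p])
  let u : Field.absoluteGaloisGroup ℚ → ℚ_[p] := fun σ => eQ σ ^ (p - 1)
  let q : ℚ_[p] := (p : ℚ_[p]) ^ M / ((2 * (p - 1) : ℕ) : ℚ_[p])
  let c : Field.absoluteGaloisGroup ℚ → ℚ_[p] := fun σ => -(q * PadicExp.plog (u σ))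
  have hu1 : ∀ σ, ‖u σ - 1‖ ≤ (p : ℝ)⁻¹ := fun σ => norm_units_pow_sub_one_le (ε σ)
  have hu1' : ∀ σ, ‖1 - u σ‖ < 1 := fun σ => norm_one_sub_units_pow_lt (ε σ)
  have hc : ∀ σ, ‖c σ‖ ≤ (p : ℝ)⁻¹ := fun σ => norm_q_mul_plog_le hp2 M (hu1 σ)
  -- `u` and `c` are homomorphisms
  have hu_mul : ∀ σ τ, u (σ * τ) = u σ * u τ := by
    intro σ τ
    simp only [u, eQ, map_mul, Units.val_mul, PadicInt.coe_mul, mul_pow]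
  have hc_mul : ∀ σ τ, c (σ * τ) = c σ + c τ := by
    intro σ τ
    simp only [c]
    rw [hu_mul, PadicExp.plog_mul (ℓ := p) (hu1' σ) (hu1' τ)]
    ring
  have hc_one_of : ∀ σ, ε σ = 1 → c σ = 0 := by
    intro σ h
    simp only [c, u, eQ, h, Units.val_one, PadicInt.coe_one, one_pow, PadicExp.plog_one, mul_zero, neg_zero]
  have hc_one : c 1 = 0 := hc_one_of 1 (map_one ε)
  -- continuity of `c`
  have hε_cont : Continuous fun σ => ((ε σ : ℤ_[p]ˣ) : ℤ_[p]) := Units.continuous_val.comp (map_continuous ε)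
  have heQ_cont : Continuous eQ := continuous_subtype_val.comp hε_cont
  have hu_cont : Continuous u := heQ_cont.pow _
  have hc_cont : Continuous c := (continuous_const.mul (continuous_plog_comp hp2 hu_cont hu1)).neg
  -- the series `E σ = Σ (c σ)ⁿ/n! Xⁿ ∈ ℤ_p⟦X⟧`
  let E : Field.absoluteGaloisGroup ℚ → PowerSeries ℤ_[p] := fun σ =>
    PowerSeries.mk fun n => ⟨c σ ^ n / (n.factorial : ℚ_[p]), norm_pow_div_factorial_le_one hp2 (hc σ) n⟩
  have hE : ∀ σ (n : ℕ), ((coeff n (E σ) : ℤ_[p]) : ℚ_[p]) = c σ ^ n / (n.factorial : ℚ_[p]) := fun σ n => by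
    simp only [E, coeff_mk]
  have hE_mul : ∀ σ τ, E (σ * τ) = E σ * E τ := fun σ τ =>
    (expSeries_mul (hE σ) (hE τ) (fun n => by rw [hE, hc_mul])).symm
  have hE_one : E 1 = 1 := expSeries_zero (fun n => by rw [hE, hc_one])
  have hE_cont : Continuous E := by
    refine continuous_pi fun d => ?_
    exact (((hc_cont.pow _).div_const _).subtype_mk _)
  -- the monoid hom and its units version
  let Θ₀ : Field.absoluteGaloisGroup ℚ →* PowerSeries ℤ_[p] := { toFun := E, map_one' := hE_one, map_mul' := hE_mul }
  let Θ : Field.absoluteGaloisGroup ℚ →ₜ* (PowerSeries ℤ_[p])ˣ :=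
    { toMonoidHom := Θ₀.toHomUnits
      continuous_toFun := by
        refine Units.continuous_iff.2 ⟨hE_cont, ?_⟩
        exact hE_cont.comp continuous_inv }
  have hΘ : ∀ σ, ((Θ σ : (PowerSeries ℤ_[p])ˣ) : PowerSeries ℤ_[p]) = E σ := fun σ => rfl
  -- (ii): the value at a member point
  have heval : ∀ t σ, (((evalHom (x t) (hx t) (E σ) : ℤ_[p])) : ℚ_[p]) = eQ σ ^ (1 - k t / 2) := by
    intro t σ
    obtain ⟨m, hm⟩ := hmemb t
    have hk : 1 - k t / 2 = -(((p : ℤ) - 1) * m) := by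
      have h2 : k t = 2 * (((p : ℤ) - 1) * m + 1) := by linear_combination hm
      rw [h2, Int.mul_ediv_cancel_left _ two_ne_zero]
      ring
    have hN : ((2 * (p - 1) : ℕ) : ℚ_[p]) ≠ 0 := by
      have h0 : (2 * (p - 1) : ℕ) ≠ 0 := Nat.mul_ne_zero two_ne_zero (Nat.sub_ne_zero_of_lt hp.out.one_lt)
      exact_mod_cast h0
    have hcast : ((2 * (p - 1) : ℕ) : ℚ_[p]) = 2 * ((p : ℚ_[p]) - 1) := by
      rw [Nat.cast_mul, Nat.cast_ofNat, Nat.cast_sub hp.out.one_lt.le, Nat.cast_one]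
    -- `c σ · x_t = (−m) · plog (u σ)` from (wt): `p^M x_t = k_t − 2 = 2(p−1) m`
    have hwtQ : (p : ℚ_[p]) ^ M * (x t : ℚ_[p]) = 2 * ((p : ℚ_[p]) - 1) * (m : ℚ_[p]) := by
      have h := congrArg (fun z : ℤ_[p] => (z : ℚ_[p])) (hwt t)
      simp only [PadicInt.coe_mul, PadicInt.coe_pow, PadicInt.coe_natCast, PadicInt.coe_intCast] at h
      rw [h, hm]
      push_cast
      ring
    have hz : c σ * (x t : ℚ_[p]) = ((-m : ℤ) : ℚ_[p]) * PadicExp.plog (u σ) := by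
      simp only [c, q]
      rw [Int.cast_neg, neg_mul, neg_mul, neg_inj, mul_right_comm, div_mul_eq_mul_div, hwtQ, hcast,
        mul_div_cancel_left₀ _ (by rw [← hcast]; exact hN)]
    rw [coe_evalHom_expSeries_eq_zpow hp2 (hc σ) (hE σ) (hx t) (hu1 σ) hz, hk]
    simp only [u, zpow_neg, ← zpow_natCast, ← zpow_mul]
    congr 1
    rw [Nat.cast_sub hp.out.one_lt.le, Nat.cast_one]
  refine ⟨Θ, fun σ => ?_, fun t σ => ?_, fun t σ => ?_, fun v hv 𝔓 h𝔓 σ hσ => ?_⟩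
  · -- (i)
    rw [hΘ]
    exact constantCoeff_expSeries (hE σ)
  · -- (ii) in `ℤ_p`
    apply Subtype.ext
    rw [hΘ, heval t σ]
    change _ = ((Units.map (PadicInt.Coe.ringHom (p := p)).toMonoidHom (ε σ ^ (1 - k t / 2)) : ℚ_[p]ˣ) : ℚ_[p])
    rw [map_zpow, Units.val_zpow_eq_zpow_val, Units.coe_map]
    rfl
  · -- (ii) in `ℚ_p`
    rw [hΘ, heval t σ]
  · -- (iii)
    have h1 : ε σ = 1 := cyclotomicCharacter_eq_one_of_mem_inertia hv h𝔓 hσ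
    apply Units.ext
    rw [hΘ, Units.val_one]
    exact expSeries_zero (fun n => by rw [hE, hc_one_of σ h1])

end Summit.BirchSwinnertonDyer.BirchSwinnertonDyer.Theorems.TelescopeBranchTwistCharacter

end
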